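import Literature.AlgebraicGeometry.HodgeTheory.WeilClassesSixfolds
import Literature.AlgebraicGeometry.HodgeTheory.ChernCharacterBetti
import Literature.AlgebraicGeometry.HodgeTheory.GlobalInvariantCycles
import Literature.AlgebraicGeometry.HodgeTheory.HodgeConjecture
import Literature.AlgebraicGeometry.Motives.FamiliesVHS
import Literature.AlgebraicGeometry.Motives.HyperbolicWeilType
import HarnessLib

/-!
# Locally algebraic Weil anchors, and Markman's secant anchor on split sixfolds (LOCAL form of arXiv:2502.03415)

Family `hodge`, layer `Literature/AlgebraicGeometry/HodgeTheory`. Requested by the B2b ladder `hodge-weil`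
(packet `run/shared/lean/b2b/hodge-weil/`, `LADDER.md ## CARVER — v3` row pv2-g3: "isolate exactly which sentence
of the preprint the floor depends on"). Two declarations:

* `HasLocallyAlgebraicWeilAnchor n d` (a PREDICATE, real definition): there is ONE abelian `2n`-fold `(P, ψ₀)` with
  `ψ₀ ≫ ψ₀ = -d`, HYPERBOLIC (`Motives.IsHyperbolicWeilType`, van Geemen's `det H = (-1)ⁿ`) for the `K`-symmetrised
  hyperplane class `h_K = d·e^*a + ψ₀^*e^*a` of a projective embedding, and ONE non-zero rational class `w` of its
  Weil plane `weilClassesOf P ψ₀ n d`, such that ALONG EVERY smooth projective family `f : 𝒳 ⟶ S` of abelian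
  `2n`-folds with `ℤ[√-d]`-action (quasi-projective total space, smooth irreducible quasi-projective base) carrying
  global classes `H ∈ H²(𝒳)` (fibrewise rational `(1,1)`) and `W ∈ H^{2n}(𝒳)` (fibrewise rational `(n,n)`) that
  restrict on a fibre `𝒳_{s₀} ≅ P` to `h_K` and `w`, the class `q·H_s^n + W_s` is ALGEBRAIC on `𝒳_s` for all `s`
  in an analytic NEIGHBOURHOOD of `s₀`, for some `q ∈ ℚ`. This is exactly the OUTPUT SHAPE of every
  semiregularity theorem at an anchor (Bloch 1972 (7.4); Buchweitz–Flenner 2003 Thm. 5.1: "`α_p(s) = ch_p(ℱ|X_s)`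
  is algebraic for all `s ∈ S` near `0`"; Markman 2025 Conj. 7.3.9 (arXiv:2502.03415v2 PDF p. 44) / §7.4 (v2 PDF
  pp. 45–49; "§7.5" in the held TeX corpus numbering): "extends … over `π⁻¹(U)` for some open analytic neighborhood
  `U` of `0`"), with the anchor class `q·h_Kⁿ + w` the middle `κ`-class of the anchor object;
  it is the LOCAL half of the "anchor ∧ transport" decomposition of Weil's question on hyperbolic components
  (the GLOBAL half — countable union of closed algebraic subsets + Baire + reach of Deligne's family — is
  kernel-checked summit-side, `Summits/HodgeConjecture/HodgeConjecture/Theorems/WeilTypeLadderLocalAnchor.lean`).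
* `Markman2025_secantAnchor_locallyAlgebraic_sixfold` (NAMED CLAIM-FACT, source UNREFEREED):
  `∀ d ≥ 1, HasLocallyAlgebraicWeilAnchor 3 d` — the local, deformation-theoretic statement that Markman's proof
  of his Thm. 1.5.1 establishes at the secant anchor `X × X̂` BEFORE the global step; see "Source" below.

## Source, verbatim (held text `paper:arxiv-2502.03415`, E. Markman, *Cycles on abelian 2n-folds of Weil type
## from secant sheaves on abelian n-folds*, arXiv:2502.03415 v2, UNREFEREED — tagged `[claim …]`)

Thm. 1.4.1 (X = Pic²(C), C a generic genus-3 curve, `F₁ = 𝓘_{∪C_i}(Θ)`, `F₂ = 𝓘_{∪Σ_i}(Θ)`, `d+1` translates,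
`d ≥ 3`, `u = √-d Θ`): "• The dual object `Φ(F₂ ⊠ F₁)^∨` is isomorphic to `𝓔[-2]`, where `𝓔` is a simple
reflexive sheaf of rank `8d` over `X × X̂` […] • The characteristic class `κ(𝓔) := exp(-c₁(𝓔)/rank(𝓔))ch(𝓔)`
remains of Hodge type under every deformation of `(X × X̂, η, h)` as a polarized abelian sixfold of Weil type […]
• The `η(K)`-translates of the graded summand `κ₃(𝓔)` of `κ(𝓔)` in `H^{3,3}(X × X̂, ℚ)`, together with `h³`,
span the 3-dimensional subspace `ℚh³ ⊕ ĤW_P` […]". Cor. 4.0.4 (arXiv v2 PDF p. 27; numbered "Cor. 4.0.7" in the held corpus rendering): "The subring `(∧^*(V_ℚ))^{Spin(V)_P}` consists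
of the direct sum of the rational 2-dimensional subspace of Hodge-Weil classes in `∧^{2n}(V_ℚ)^{Spin(V)_P}` and
the space of powers of classes in the one-dimensional `∧²(V_ℚ)^{Spin(V)_P}`" (and Cor. 1.3.2: `κ(E)` is
`Spin(V)_P`-invariant; §1.3: "`H²(X × X̂, ℚ)^{Spin(V)_P}` is one-dimensional spanned by an ample class `h` […]
`η(k)` maps `h` to `Nm(k)h`"). Lemma 3.1.3: "the discriminant of the hermitian form `H` is `(-1)ⁿ`."
§1.5 (the paragraph preceding Thm. 1.5.1): "we associate to `𝓔̄` a reflexive sheaf `𝓑`, twisted by a Čech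
2-cocycle with coefficients in `μ_{8d}` […] satisfying `κ(𝓔) = q^*κ(𝓑)`. Such a sheaf `𝓑` is constructed,
regardless of the parity of `d`. The morphism `q` induces a local isomorphism of the Kuranishi deformation spaces
of `X × X̂` and `Y`. Our verification of Conjecture 7.3.9 in the case of abelian varieties implies that `(Y, 𝓑)`
deforms locally over the locus where `κ(𝓑)` remains of Hodge-type. Hence, `(X × X̂, q^*𝓑)` deforms locally over
the locus where `q^*κ(𝓑)` remains of Hodge type." Conj. 7.3.9 (proved in §7.4.2 [v2 pp. 47–49; held "§7.5.2"] "when `π : 𝓜 → S` is a family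
of connected abelian varieties"): "Let `π : 𝓜 → S` be a deformation of a smooth complex projective variety `M₀`
over a smooth germ `(S, 0)` […] Assume that `𝓑` is a semiregular rank `r` coherent sheaf over `M₀`, twisted by a
cocycle with coefficients in `μ_r`, such that for all `p` the class `ch_p(𝓑)` extends to a horizontal section of
`R^{2p}π_*ℚ`, which belongs to the direct summand `R^pπ_*Ω^p_π` under the Hodge decomposition. Then `𝓑` extends
to a twisted coherent sheaf over `π⁻¹(U)` for some open analytic neighborhood `U` of `0` in `S`." Lemma 9.3.11:
"The twisted reflexive sheaf `𝓑` is semiregular." Proof of Thm. 1.5.1 (§9.3, after Lemma 9.3.11): "The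
algebraicity of `κ₃(𝓑)` follows in a non-empty open subset in moduli from the semiregularity of `𝓑`, proved in
Lemma 9.3.11, and Conjecture 7.3.9 […] The algebraicity of the Hodge-Weil classes follows from that of `κ₃(𝓑)`
and Theorem 1.4.1 […]. The locus in moduli where the Hodge-Weil classes are algebraic is a countable union of
closed algebraic susbsets [voisin]. Hence, the locus contains the whole irreducible component of moduli of
deformations of `(X × X̂, η, h)`." Footnote to §1.5: "If `d` is odd replace it with `4d` and note that
`ℚ(√-4d) = ℚ(√-d)`."

## Rendering of the claim-fact (what is asserted, and why it is a consequence of the quoted sentences)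

REGIME (referee-g8 G17): Markman's secant anchor exists VERBATIM only for `d` EVEN with `d ≥ 4` (Thm. 1.4.1 needs
`d ≥ 3`, p. 57 "for a generic choice of the curves", and the `Ḡ`-linearisation of §1.5 / §9.3 needs `d` even,
p. 71 with the footnote "`ℚ(√-d) = ℚ(√-4d)`, so the assumption that `d` is even does not restrict the complex
multiplications we can treat"). For such `d` the witness below is literally Markman's. For every other `d` the
statement `HasLocallyAlgebraicWeilAnchor 3 d` is obtained from the `4d`-anchor by the isogeny-transport paragraph
below, which is RENDERING GLUE, NOT A SENTENCE OF [Mar25] (sound, elementary, not kernel-checked). Consumers that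
need the fact only through the field `K = ℚ(√-d)` should instantiate it at `4d` (`d ≥ 1`), where it is verbatim:
summit-side, `Theorems/WeilTypeLadderLocalAnchorFourMul.lean` derives the floor
`Markman2025_weilClasses_algebraic_hyperbolicSixfold` from `weilFamilyReach_hyperbolic` and
`∀ d ≥ 1, HasLocallyAlgebraicWeilAnchor 3 (4d)` alone, the passage `(A, φ, d) ↦ (A, 2φ, 4d)` being kernel-checked
there on the TARGETS — so no consumer of the floor depends on the glue.

Witness for `d` even, `d ≥ 4` (verbatim): `P = X × X̂`, `ψ₀ = φ_d : (x, y) ↦ (-d θ⁻¹y, θx)` (`φ_d² = -d`, `θ` the principal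
polarization; `η(√-d) = φ_d`), `e` a projective embedding by a multiple `mh` of Markman's `Spin(V)_P`-invariant
ample class `h` (so `h_K = d·e^*a + φ_d^*e^*a = 2dmq·h`, as `φ_d^*h = Nm(√-d)h = dh`), hyperbolic by Lemma 3.1.3
(`det H = (-1)³`, van Geemen's dictionary recorded in `Motives/HyperbolicWeilType`), and `w = w₀ := κ₃(𝓔) - q₃h³`,
the Weil component of `κ₃(𝓔)` (Cor. 4.0.4 [v2 p. 27; corpus "4.0.7"]: `κ(𝓔) ∈ ℚ[h] ⊕ ĤW_P`, so `κ_k(𝓔) = q_k hᵏ` for `k ≠ 3` and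
`κ₃(𝓔) = q₃h³ + w₀` with `w₀` a RATIONAL class of the Weil plane `ĤW_P = weilClassesOf P φ_d 3 d ⊗ ℚ`;
`w₀ ≠ 0` by Thm. 1.4.1, 4th item, since `η(K)`-translates of `h³` are multiples of `h³`). Local algebraicity:
given a family `f`, classes `H, W` and a chart `e' : P ≅ 𝒳_{s₀}` as in the predicate, the flat transport of
`κ(𝓔) = Σ_k q'_k h_Kᵏ + w₀` along `S(ℂ)` near `s₀` is `Σ_k q'_k H_sᵏ + W_s`, of Hodge type on every fibre (the
hypotheses on `H`, `W`), i.e. "`κ(𝓔)` remains of Hodge type" over the smooth germ `(S(ℂ), s₀)`, whose fibres are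
abelian varieties; by versality the germ maps to the Kuranishi space of `X × X̂`, into the locus over which
`(X × X̂, q^*𝓑)` deforms (quoted §1.5 sentence = Lemma 9.3.11 + Conj. 7.3.9 proved in §7.4.2 [v2; held "§7.5.2"]); the pulled-back
twisted sheaves on the fibres `𝒳_s`, `s` in an open neighbourhood `U` of `s₀`, have `κ`-class the transport of
`κ(𝓔)`, and the `κ`-class of a twisted coherent sheaf on a smooth projective variety is algebraic ("The
algebraicity of `κ₃(𝓑)` follows in a non-empty open subset"); hence `q'₃·H_s³ + W_s` is algebraic for `s ∈ U` —
the conclusion, with `q = q'₃`. For `d` odd or `d = 2` (RENDERING GLUE, not in [Mar25]; see REGIME above): run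
the construction with `4d` and transport along the `K`-isogeny `g = ([2], 1) : (X × X̂, η_d) → (X × X̂, η_{4d})`
(`φ_{4d} ∘ g = g ∘ 2φ_d`, kernel `X[2] × 0`): a family through `(X × X̂, φ_d)` as in the predicate is, over an
analytic neighbourhood of `s₀`, the source of a fibrewise isogeny onto a family through Markman's anchor (2-torsion
is locally constant; `2φ''` kills `𝒳_s[2]`, so the `K`-action descends), `H`, `W` correspond under the
rational-cohomology isomorphisms `g_s^*`, the `κ`-class of `𝓔_{4d}` stays Hodge there, and algebraicity pulls back
along `g_s` — the same local-isomorphism-of-Kuranishi-spaces manoeuvre as Markman's own passage `q : X × X̂ → Y`;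
the anchor is then `(X × X̂, φ_d)`, hyperbolic for `g^*h` (the discriminant is an isogeny invariant, van Geemen
5.2 (3)).
So the fact asserts, per `d`, ONE local statement at ONE point; it says nothing away from a neighbourhood of the
secant anchor. It is NOT implied by the tree's rendering `Markman2025_weilClasses_algebraic_hyperbolicSixfold` of
Thm. 1.5.1 (that needs "nearby fibres are hyperbolic Weil sixfolds with `W_s` in their Weil planes", true but not on
the tree's carriers), and conversely implies it only together with the reach of Deligne's family and the
countable-union/Baire step — which is the point: summit-side,
`Markman2025_weilClasses_algebraic_hyperbolicSixfold` is DERIVED from this fact, `weilFamilyReach_hyperbolic`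
(Deligne 1982 / van Geemen / Landherr / Mumford–Fogarty–Kirwan / Milne, refereed) and kernel-checked glue.

## Why the anchor OBJECT is not typed here

The object-level cut ("`𝓑` is semiregular" + "a twisted semiregularity theorem") would need the Buchweitz–Flenner
map of a `μ_r`-TWISTED REFLEXIVE sheaf on a quotient sixfold; the tree's real semiregularity carriers
(`SemiregularityHigherSigma.sigmaHigher`, `IsISemiregular`) need `E` finite locally free and untwisted, and the
hypothesis-structure layer (`SemiregularityMap.SemiregularityData`) cannot be quantified over in a named fact
without becoming unsound. The class-level local statement is the finest cut available on current carriers; the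
summit-side twisted engine (`Theorems/WeilTypeLadderQuadraticVariationalEngineTwisted.lean`) shows that Perry's
Thm. 1.1 with a `B`-field at a LOCALLY FREE `κ`-anchor would give the same predicate.

## References

* [Markman2025SecantWeil] E. Markman, arXiv:2502.03415 v2 (2025), Thm. 1.4.1, Cor. 1.3.2, §1.5 and Thm. 1.5.1,
  Lemma 3.1.3, Cor. 4.0.4 (corpus "4.0.7"), Conj. 7.3.9, §7.4.2 (v2 pp. 47–49; held "§7.5.2"), Lemma 9.3.11, proof of Thm. 1.5.1 (§9.3). UNREFEREED.
* [BuchweitzFlenner2003] R.-O. Buchweitz, H. Flenner, Compositio Math. 137 (2003), Thm. 5.1 (the local shape).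
* [vanGeemen1994HodgeAV] B. van Geemen, LNM 1594 (1994), Lemma 5.2, 5.4 (hyperbolic = `det H = (-1)ⁿ`).
* [VoisinHodgeII2003] C. Voisin, Hodge Theory and Complex Algebraic Geometry II, §5.3.3 (Hodge loci; the
  countable-union step quoted above is NOT part of this fact).
-/

noncomputable section

open CategoryTheory

namespace Literature.AlgebraicGeometry.HodgeTheory

open Literature.AlgebraicTopology.SingularHomology

section HodgeTheory

/-- **A locally algebraic hyperbolic Weil anchor in dimension `2n` for `K = ℚ(√-d)`.** There are a complex
abelian `2n`-fold `P` with `ψ₀ ≫ ψ₀ = -(d • 𝟙 P)`, a projective embedding `e` and a rational `a ≠ 0` in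
`H²(ℙᴺ(ℂ); ℂ)` with `(P, ψ₀)` of HYPERBOLIC Weil type for `h_K = d·e^*a + ψ₀^*e^*a`, and a non-zero rational
class `w` of the Weil plane `weilClassesOf P ψ₀ n d`, such that: for every smooth projective family
`f : 𝒳 ⟶ S` of relative dimension `2n` (`𝒳`, `S` quasi-projective, `S` smooth irreducible) all of whose fibres
are abelian `2n`-folds with an endomorphism of square `-d`, all global classes `H ∈ H²(𝒳(ℂ); ℂ)` with rational
`(1,1)` fibre restrictions and `W ∈ H^{2n}(𝒳(ℂ); ℂ)` with rational `(n,n)` fibre restrictions, every complex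
point `s₀` and chart `e' : P.X ≅ 𝒳_{s₀}` with `e'^*(H|_{𝒳_{s₀}}) = h_K` and `e'^*(W|_{𝒳_{s₀}}) = w`, there are
an OPEN `U ∋ s₀` in `S(ℂ)` and `q ∈ ℚ` with `q·(H|_{𝒳_s})ⁿ + W|_{𝒳_s} ∈ algebraicClasses (𝒳_s) n` for every
`s ∈ U`. (The local output of a semiregularity theorem — Bloch (7.4), Buchweitz–Flenner Thm. 5.1, Markman
Conj. 7.3.9/§7.4 [v2 pp. 45–49; held "§7.5"], Perry Thm. 1.1 — applied to an anchor object whose middle (`κ`-)class is `q·h_Kⁿ + w`;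
module docstring.) [cite: BuchweitzFlenner2003, Thm. 5.1] [cite: Markman2025SecantWeil, §1.5] -/
def HasLocallyAlgebraicWeilAnchor (n d : ℕ) : Prop :=
  ∃ (P : Motives.AbelianVariety ℂ) (ψ₀ : P ⟶ P) (e : Motives.ProjectiveEmbedding P.X)
    (a : complexBetti (Motives.projectiveSpace e.n ℂ) 2) (w : complexBetti P.X (2 * n)),
    P.dim = 2 * n ∧ ψ₀ ≫ ψ₀ = -(d • 𝟙 P) ∧ IsRationalClass a ∧ a ≠ 0 ∧
    Motives.IsHyperbolicWeilType P ψ₀ n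
      ((d : ℂ) • complexBetti.map e.ι 2 a + complexBetti.map ψ₀.hom.hom.hom 2 (complexBetti.map e.ι 2 a)) ∧
    w ∈ weilClassesOf P ψ₀ n d ∧ IsRationalClass w ∧ w ≠ 0 ∧
    ∀ ⦃𝒳 S : Motives.SchemeOver ℂ⦄ (f : 𝒳 ⟶ S), Motives.IsSmoothProjectiveFamily f (2 * n) →
      IsQuasiProjectiveOver 𝒳 → IsQuasiProjectiveOver S → IrreducibleSpace S.left →
      AlgebraicGeometry.Smooth S.hom →
      (∀ s : Motives.ComplexPoints S, ∃ (A'' : Motives.AbelianVariety ℂ) (φ'' : A'' ⟶ A''),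
          A''.dim = 2 * n ∧ φ'' ≫ φ'' = -(d • 𝟙 A'') ∧ Nonempty (A''.X ≅ Motives.fiberOver f s)) →
      ∀ (H : complexBetti 𝒳 2) (W : complexBetti 𝒳 (2 * n)),
        (∀ s : Motives.ComplexPoints S,
          IsRationalClass (complexBetti.map (Motives.fiberι f s) 2 H) ∧
            IsOfHodgeType (2 * n) (Motives.fiberOver f s) 2 1 1 (complexBetti.map (Motives.fiberι f s) 2 H)) →
        (∀ s : Motives.ComplexPoints S,
          IsRationalClass (complexBetti.map (Motives.fiberι f s) (2 * n) W) ∧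
            IsOfHodgeType (2 * n) (Motives.fiberOver f s) (2 * n) n n
              (complexBetti.map (Motives.fiberι f s) (2 * n) W)) →
        ∀ (s₀ : Motives.ComplexPoints S) (e' : P.X ≅ Motives.fiberOver f s₀),
          complexBetti.map e'.hom 2 (complexBetti.map (Motives.fiberι f s₀) 2 H) =
            (d : ℂ) • complexBetti.map e.ι 2 a + complexBetti.map ψ₀.hom.hom.hom 2 (complexBetti.map e.ι 2 a) →
          complexBetti.map e'.hom (2 * n) (complexBetti.map (Motives.fiberι f s₀) (2 * n) W) = w →
          ∃ (U : Set (Motives.ComplexPoints S)) (q : ℚ), IsOpen U ∧ s₀ ∈ U ∧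
            ∀ s ∈ U, ((q : ℚ) : ℂ) • cupPowTwo (complexBetti.map (Motives.fiberι f s) 2 H) n +
              complexBetti.map (Motives.fiberι f s) (2 * n) W ∈ algebraicClasses (Motives.fiberOver f s) n

/-- **Markman 2025 (arXiv:2502.03415, UNREFEREED), the LOCAL statement at the secant anchor: for every
`d ≥ 1` the split `ℚ(√-d)`-Weil sixfold `X × X̂` (`X` the Jacobian of a generic genus-3 curve,
`η(√-d) = φ_d`, discriminant `(-1)³`, Lemma 3.1.3) with the Weil component `w₀ ≠ 0` of `κ₃` of the secant⊠²
sheaf `𝓔` (Thm. 1.4.1, Cor. 4.0.4 [v2 p. 27; corpus "4.0.7"]) is a locally algebraic hyperbolic Weil anchor** — "`(X × X̂, q^*𝓑)` deforms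
locally over the locus where `q^*κ(𝓑) [= κ(𝓔)]` remains of Hodge type" (§1.5; Lemma 9.3.11 + Conj. 7.3.9
proved for families of abelian varieties in §7.4.2 [v2 pp. 47–49; held "§7.5.2"]), whence "the algebraicity of `κ₃` follows in a non-empty
open subset" (proof of Thm. 1.5.1, §9.3), along every smooth projective family of abelian sixfolds through
the anchor on which the polarization class and `w₀` extend to Hodge global classes. Rendering, witness and
faithfulness: module docstring — VERBATIM Markman's for `d` even `≥ 4`; for other `d` via his footnote `d ↦ 4d`
plus an isogeny transport that is rendering glue, NOT in the source (referee G17); consumers needing only the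
field instantiate at `4d` (`Theorems/WeilTypeLadderLocalAnchorFourMul.lean` derives the floor that way, with the
transport kernel-checked on the targets). The GLOBAL consequence (Thm. 1.5.1 = `Markman2025_weilClasses_algebraic_hyperbolicSixfold`) is
DERIVED from this summit-side; nothing global is asserted here. Users take
`(h : Markman2025_secantAnchor_locallyAlgebraic_sixfold)`.
[claim: Markman2025SecantWeil, status: under-review] -/
def Markman2025_secantAnchor_locallyAlgebraic_sixfold : Prop :=
  ∀ d : ℕ, 0 < d → HasLocallyAlgebraicWeilAnchor 3 d

/-! ### Sanity: the local clause is implied by global algebraicity of the Weil section (e.g. under `HodgeConjectureFor`) -/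

/-- **Global algebraicity gives the local clause** (consistency / upper bound of the local clause): if along a
family every restriction `W|_{𝒳_s}` is already algebraic, the conclusion of the local clause holds with
`U = S(ℂ)` and `q = 0`. In particular, under `HodgeConjectureFor` on all fibres the local clause of
`HasLocallyAlgebraicWeilAnchor` is automatic and the predicate reduces to the EXISTENCE of a hyperbolic
`(P, ψ₀, h_K)` with a non-zero rational Weil class. [folklore] -/
theorem localClause_of_forall_mem_algebraicClasses {n : ℕ} {𝒳 S : Motives.SchemeOver ℂ} (f : 𝒳 ⟶ S)
    (H : complexBetti 𝒳 2) (W : complexBetti 𝒳 (2 * n)) (s₀ : Motives.ComplexPoints S)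
    (hW : ∀ s : Motives.ComplexPoints S,
      complexBetti.map (Motives.fiberι f s) (2 * n) W ∈ algebraicClasses (Motives.fiberOver f s) n) :
    ∃ (U : Set (Motives.ComplexPoints S)) (q : ℚ), IsOpen U ∧ s₀ ∈ U ∧
      ∀ s ∈ U, ((q : ℚ) : ℂ) • cupPowTwo (complexBetti.map (Motives.fiberι f s) 2 H) n +
        complexBetti.map (Motives.fiberι f s) (2 * n) W ∈ algebraicClasses (Motives.fiberOver f s) n :=
  ⟨Set.univ, 0, isOpen_univ, Set.mem_univ _, fun s _ => by
    rw [Rat.cast_zero, zero_smul, zero_add]; exact hW s⟩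

end HodgeTheory

end Literature.AlgebraicGeometry.HodgeTheory

end
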